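import Summits.CriticalPhenomena.PercolationContinuityZ3.Theorems.PercNearOneGluingNoHeavyLowerTailKnQuestion8AntitheticWedgeQuadRel
import HarnessLib

/-!
# `NoHeavyLowerTail` (crux stmt-CriticalPhenomena-4575), antithetic vdBHK programme: THEOREM C in RELATION FORM — a nested violation of (R)(X,L) LIFTS to
# a nested violation of (R)(T(X;L), L_T), with the full T-pattern data needed to lift again (iteration along the T-tower)

Support file (seat `prim-ineq-gen-7` gen 53; `--supports stmt-CriticalPhenomena-4575`).  No `sorry`, no definitions.  Memo: FINDING-UNCROSS-g53.md §3.

`AntitheticWedgeConverse.not_R_newleaf_of_nested_violation` (g52, THEOREM C) concludes `¬ (R)(T(X;L), L_T)` from a nested violating configuration of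
(R)(X,L), for a `PartialOrder X`.  This file proves the SAME construction for an abstract reflexive–transitive relation `r` (so that it applies to
`X × Fin 4` with the wedge relation, which carries no order instance) and returns the lifted configuration ITSELF: two T-pattern quadruples
`(P₁,P₂,P₃,P₄) = (𝐭, 𝐬, 𝐭, 𝐚₄)`, `(Q₁,Q₂,Q₃,Q₄) = (𝐩, 𝐮, 𝐯, 𝐪)` of up-sets of `T(X;L)` (relation `r p.1 q.1 ∧ SHEET`, half
`L_T = Finset.univ.filter (·.2 ≤ 1)`, involution `(ι, s)`) satisfying all twelve + twelve pattern conditions of (R)(T(X;L),L_T), NESTED (`P₃ ⊆ P₂`) and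
VIOLATING: `#(P₂ ∩ Q₂) + #(P₃ ∩ Q₃) + #((P₄ ∖ P₁) ∩ (Q₄ ∖ Q₁)) < #(P₂ ∩ ι_T Q₃) + #(P₃ ∩ ι_T Q₂)`.  Template (`U = ↑_r(α₂ ∩ L)`, `σ = U ∪ (α₃ ∖ L)`,
`γ = U ∪ α₃`, `β₃' = {x ∈ β₃ : x ∉ L ∨ ↑_r x ∖ L ⊆ β₂}`, `q₂ = β₂ ∪ (↑_r(β₃ ∩ L) ∖ L)`): `𝐬 = (σ,σ,α₂,σ)`, `𝐭 = (σ,α₃,σ,σ)`, `𝐚₄ = (σ,γ,α₂,γ)`,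
`𝐩 = (∅,β₃',β₂,X)`, `𝐮 = (∅,∅,β₂,X)`, `𝐯 = (∅,β₃,X,X)`, `𝐪 = (∅,β₃,q₂,X)` — as in THEOREM C.
* `AntitheticWedgeConverseRel.nested_violation_lifts` — the statement above.  Since its conclusion contains the hypotheses of the theorem one level
  up (with `AntitheticWedgeQuadRel.rel_refl / rel_trans / rel_half_down / rel_invol` supplying the structural ones), it ITERATES: a nested violation of
  (R)(X,L) gives nested violations of (R)(Tᵏ(X;L), L_{Tᵏ}) for every `k ≥ 1` (`AntitheticWedgeTower`, this generation, spells out `k = 2`).  This is the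
  abstract engine of THEOREM P⁻ of g52 ((R)(Ω_T, v) for a tree `T` only at path ends), whose other inputs are the certified W@middle witness and
  `AntitheticWedgeDescent`.
-/

namespace Summit.CriticalPhenomena.PercolationContinuityZ3.Theorems

open Finset

namespace AntitheticWedgeConverseRel

variable {X : Type*} [DecidableEq X] [Fintype X]

/-- **THEOREM C, relation form, with the lifted configuration as output.**  See the module docstring. [this work] -/
theorem nested_violation_lifts (r : X → X → Prop) (hrefl : ∀ x, r x x) (htrans : ∀ x y z, r x y → r y z → r x z)
    (ι : X → X) (hι : Function.Involutive ι)
    (L : Finset X) (hLdown : ∀ x y : X, r x y → y ∈ L → x ∈ L)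
    (s : Fin 4 → Fin 4) (hs0 : s 0 = 3) (hs1 : s 1 = 2) (hs2 : s 2 = 1) (hs3 : s 3 = 0)
    (α₂ α₃ β₂ β₃ A₁ A₄ B₁ B₄ : Finset X)
    (hα₂ : ∀ x y, r x y → x ∈ α₂ → y ∈ α₂) (hα₃ : ∀ x y, r x y → x ∈ α₃ → y ∈ α₃)
    (hβ₂ : ∀ x y, r x y → x ∈ β₂ → y ∈ β₂) (hβ₃ : ∀ x y, r x y → x ∈ β₃ → y ∈ β₃) (hB₁ : ∀ x y, r x y → x ∈ B₁ → y ∈ B₁)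
    (hnest : α₃ ⊆ α₂) (hCα : ∀ x y, r x y → x ∈ L → y ∉ L → x ∈ α₂ → y ∈ α₃)
    (hA₁ : A₁ ⊆ α₃) (hA₄ : α₂ ⊆ A₄) (hB₃₄ : ∀ x, x ∈ L → x ∈ β₃ → x ∈ B₄) (hB₁₂ : ∀ x, x ∉ L → x ∈ B₁ → x ∈ β₂)
    (hBC : ∀ x y, r x y → x ∈ L → y ∉ L → x ∈ β₃ → y ∈ B₄)
    (hviol : (α₂ ∩ β₂).card + (α₃ ∩ β₃).card + ((A₄ \ A₁) ∩ (B₄ \ B₁)).card < (α₂ ∩ β₃.image ι).card + (α₃ ∩ β₂.image ι).card) :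
    ∃ P₁ P₂ P₃ P₄ Q₁ Q₂ Q₃ Q₄ : Finset (X × Fin 4),
      (∀ p q : X × Fin 4, (r p.1 q.1 ∧ (p.2 = q.2 ∨ (p.2 = 0 ∧ q.2 = 2) ∨ (p.2 = 1 ∧ q.2 = 3) ∨ (p.2 = 0 ∧ q.2 = 3) ∨ (p.2 = 2 ∧ q.2 = 3 ∧ p.1 ∈ L) ∨
        (p.2 = 0 ∧ q.2 = 1 ∧ q.1 ∉ L) ∨ (p.2 = 1 ∧ q.2 = 2 ∧ p.1 ∈ L ∧ q.1 ∉ L))) → p ∈ P₁ → q ∈ P₁) ∧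
      (∀ p q : X × Fin 4, (r p.1 q.1 ∧ (p.2 = q.2 ∨ (p.2 = 0 ∧ q.2 = 2) ∨ (p.2 = 1 ∧ q.2 = 3) ∨ (p.2 = 0 ∧ q.2 = 3) ∨ (p.2 = 2 ∧ q.2 = 3 ∧ p.1 ∈ L) ∨
        (p.2 = 0 ∧ q.2 = 1 ∧ q.1 ∉ L) ∨ (p.2 = 1 ∧ q.2 = 2 ∧ p.1 ∈ L ∧ q.1 ∉ L))) → p ∈ P₂ → q ∈ P₂) ∧
      (∀ p q : X × Fin 4, (r p.1 q.1 ∧ (p.2 = q.2 ∨ (p.2 = 0 ∧ q.2 = 2) ∨ (p.2 = 1 ∧ q.2 = 3) ∨ (p.2 = 0 ∧ q.2 = 3) ∨ (p.2 = 2 ∧ q.2 = 3 ∧ p.1 ∈ L) ∨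
        (p.2 = 0 ∧ q.2 = 1 ∧ q.1 ∉ L) ∨ (p.2 = 1 ∧ q.2 = 2 ∧ p.1 ∈ L ∧ q.1 ∉ L))) → p ∈ P₃ → q ∈ P₃) ∧
      (∀ p q : X × Fin 4, (r p.1 q.1 ∧ (p.2 = q.2 ∨ (p.2 = 0 ∧ q.2 = 2) ∨ (p.2 = 1 ∧ q.2 = 3) ∨ (p.2 = 0 ∧ q.2 = 3) ∨ (p.2 = 2 ∧ q.2 = 3 ∧ p.1 ∈ L) ∨
        (p.2 = 0 ∧ q.2 = 1 ∧ q.1 ∉ L) ∨ (p.2 = 1 ∧ q.2 = 2 ∧ p.1 ∈ L ∧ q.1 ∉ L))) → p ∈ P₄ → q ∈ P₄) ∧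
      (∀ p q : X × Fin 4, (r p.1 q.1 ∧ (p.2 = q.2 ∨ (p.2 = 0 ∧ q.2 = 2) ∨ (p.2 = 1 ∧ q.2 = 3) ∨ (p.2 = 0 ∧ q.2 = 3) ∨ (p.2 = 2 ∧ q.2 = 3 ∧ p.1 ∈ L) ∨
        (p.2 = 0 ∧ q.2 = 1 ∧ q.1 ∉ L) ∨ (p.2 = 1 ∧ q.2 = 2 ∧ p.1 ∈ L ∧ q.1 ∉ L))) → p ∈ Q₁ → q ∈ Q₁) ∧
      (∀ p q : X × Fin 4, (r p.1 q.1 ∧ (p.2 = q.2 ∨ (p.2 = 0 ∧ q.2 = 2) ∨ (p.2 = 1 ∧ q.2 = 3) ∨ (p.2 = 0 ∧ q.2 = 3) ∨ (p.2 = 2 ∧ q.2 = 3 ∧ p.1 ∈ L) ∨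
        (p.2 = 0 ∧ q.2 = 1 ∧ q.1 ∉ L) ∨ (p.2 = 1 ∧ q.2 = 2 ∧ p.1 ∈ L ∧ q.1 ∉ L))) → p ∈ Q₂ → q ∈ Q₂) ∧
      (∀ p q : X × Fin 4, (r p.1 q.1 ∧ (p.2 = q.2 ∨ (p.2 = 0 ∧ q.2 = 2) ∨ (p.2 = 1 ∧ q.2 = 3) ∨ (p.2 = 0 ∧ q.2 = 3) ∨ (p.2 = 2 ∧ q.2 = 3 ∧ p.1 ∈ L) ∨
        (p.2 = 0 ∧ q.2 = 1 ∧ q.1 ∉ L) ∨ (p.2 = 1 ∧ q.2 = 2 ∧ p.1 ∈ L ∧ q.1 ∉ L))) → p ∈ Q₃ → q ∈ Q₃) ∧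
      (∀ p q : X × Fin 4, (r p.1 q.1 ∧ (p.2 = q.2 ∨ (p.2 = 0 ∧ q.2 = 2) ∨ (p.2 = 1 ∧ q.2 = 3) ∨ (p.2 = 0 ∧ q.2 = 3) ∨ (p.2 = 2 ∧ q.2 = 3 ∧ p.1 ∈ L) ∨
        (p.2 = 0 ∧ q.2 = 1 ∧ q.1 ∉ L) ∨ (p.2 = 1 ∧ q.2 = 2 ∧ p.1 ∈ L ∧ q.1 ∉ L))) → p ∈ Q₄ → q ∈ Q₄) ∧
      P₁ ⊆ P₃ ∧ P₂ ⊆ P₄ ∧ (∀ p, p.2 ≤ 1 → p ∈ P₃ → p ∈ P₄) ∧ (∀ p, ¬ p.2 ≤ 1 → p ∈ P₁ → p ∈ P₂) ∧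
      (∀ p q : X × Fin 4, (r p.1 q.1 ∧ (p.2 = q.2 ∨ (p.2 = 0 ∧ q.2 = 2) ∨ (p.2 = 1 ∧ q.2 = 3) ∨ (p.2 = 0 ∧ q.2 = 3) ∨ (p.2 = 2 ∧ q.2 = 3 ∧ p.1 ∈ L) ∨
        (p.2 = 0 ∧ q.2 = 1 ∧ q.1 ∉ L) ∨ (p.2 = 1 ∧ q.2 = 2 ∧ p.1 ∈ L ∧ q.1 ∉ L))) → p.2 ≤ 1 → ¬ q.2 ≤ 1 → p ∈ P₃ → q ∈ P₄) ∧
      (∀ p q : X × Fin 4, (r p.1 q.1 ∧ (p.2 = q.2 ∨ (p.2 = 0 ∧ q.2 = 2) ∨ (p.2 = 1 ∧ q.2 = 3) ∨ (p.2 = 0 ∧ q.2 = 3) ∨ (p.2 = 2 ∧ q.2 = 3 ∧ p.1 ∈ L) ∨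
        (p.2 = 0 ∧ q.2 = 1 ∧ q.1 ∉ L) ∨ (p.2 = 1 ∧ q.2 = 2 ∧ p.1 ∈ L ∧ q.1 ∉ L))) → p.2 ≤ 1 → ¬ q.2 ≤ 1 → p ∈ P₂ → q ∈ P₃) ∧
      Q₁ ⊆ Q₃ ∧ Q₂ ⊆ Q₄ ∧ (∀ p, p.2 ≤ 1 → p ∈ Q₃ → p ∈ Q₄) ∧ (∀ p, ¬ p.2 ≤ 1 → p ∈ Q₁ → p ∈ Q₂) ∧
      (∀ p q : X × Fin 4, (r p.1 q.1 ∧ (p.2 = q.2 ∨ (p.2 = 0 ∧ q.2 = 2) ∨ (p.2 = 1 ∧ q.2 = 3) ∨ (p.2 = 0 ∧ q.2 = 3) ∨ (p.2 = 2 ∧ q.2 = 3 ∧ p.1 ∈ L) ∨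
        (p.2 = 0 ∧ q.2 = 1 ∧ q.1 ∉ L) ∨ (p.2 = 1 ∧ q.2 = 2 ∧ p.1 ∈ L ∧ q.1 ∉ L))) → p.2 ≤ 1 → ¬ q.2 ≤ 1 → p ∈ Q₃ → q ∈ Q₄) ∧
      (∀ p q : X × Fin 4, (r p.1 q.1 ∧ (p.2 = q.2 ∨ (p.2 = 0 ∧ q.2 = 2) ∨ (p.2 = 1 ∧ q.2 = 3) ∨ (p.2 = 0 ∧ q.2 = 3) ∨ (p.2 = 2 ∧ q.2 = 3 ∧ p.1 ∈ L) ∨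
        (p.2 = 0 ∧ q.2 = 1 ∧ q.1 ∉ L) ∨ (p.2 = 1 ∧ q.2 = 2 ∧ p.1 ∈ L ∧ q.1 ∉ L))) → p.2 ≤ 1 → ¬ q.2 ≤ 1 → p ∈ Q₂ → q ∈ Q₃) ∧
      P₃ ⊆ P₂ ∧
      (P₂ ∩ Q₂).card + (P₃ ∩ Q₃).card + ((P₄ \ P₁) ∩ (Q₄ \ Q₁)).card <
        (P₂ ∩ Q₃.image (fun p => (ι p.1, s p.2))).card + (P₃ ∩ Q₂.image (fun p => (ι p.1, s p.2))).card := by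
  classical
  -- X-level pieces of the template
  set U : Finset X := Finset.univ.filter (fun y => ∃ x ∈ α₂, x ∈ L ∧ r x y) with hUdef
  set σ : Finset X := U ∪ α₃.filter (fun y => y ∉ L) with hσdef
  set γ : Finset X := U ∪ α₃ with hγdef
  set β₃' : Finset X := β₃.filter (fun x => x ∉ L ∨ ∀ t, r x t → t ∉ L → t ∈ β₂) with hβ₃'def
  set W : Finset X := Finset.univ.filter (fun t => t ∉ L ∧ ∃ x ∈ β₃, x ∈ L ∧ r x t) with hWdef
  set q₂ : Finset X := β₂ ∪ W with hq₂def
  have memU : ∀ y, y ∈ U ↔ ∃ x ∈ α₂, x ∈ L ∧ r x y := fun y => by simp [hUdef]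
  have memσ : ∀ y, y ∈ σ ↔ y ∈ U ∨ (y ∈ α₃ ∧ y ∉ L) := fun y => by simp [hσdef, Finset.mem_union, Finset.mem_filter]
  have memγ : ∀ y, y ∈ γ ↔ y ∈ U ∨ y ∈ α₃ := fun y => by simp [hγdef]
  have memβ₃' : ∀ x, x ∈ β₃' ↔ x ∈ β₃ ∧ (x ∉ L ∨ ∀ t, r x t → t ∉ L → t ∈ β₂) := fun x => by simp [hβ₃'def]
  have memW : ∀ t, t ∈ W ↔ t ∉ L ∧ ∃ x ∈ β₃, x ∈ L ∧ r x t := fun t => by simp [hWdef]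
  have memq₂ : ∀ t, t ∈ q₂ ↔ t ∈ β₂ ∨ t ∈ W := fun t => by simp [hq₂def]
  -- basic X-level facts
  have Uup : ∀ x y, r x y → x ∈ U → y ∈ U := by
    intro x y hxy hx; rw [memU] at hx ⊢; obtain ⟨z, hz, hzL, hzx⟩ := hx; exact ⟨z, hz, hzL, htrans _ _ _ hzx hxy⟩
  have Usubα₂ : ∀ y, y ∈ U → y ∈ α₂ := by
    intro y hy; rw [memU] at hy; obtain ⟨z, hz, _, hzy⟩ := hy; exact hα₂ z y hzy hz
  have UPα₃ : ∀ y, y ∈ U → y ∉ L → y ∈ α₃ := by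
    intro y hy hyL; rw [memU] at hy; obtain ⟨z, hz, hzL, hzy⟩ := hy; exact hCα z y hzy hzL hyL hz
  have σup : ∀ x y, r x y → x ∈ σ → y ∈ σ := by
    intro x y hxy hx; rw [memσ] at hx ⊢
    rcases hx with hx | ⟨hx, hxL⟩
    · exact Or.inl (Uup x y hxy hx)
    · exact Or.inr ⟨hα₃ x y hxy hx, fun hyL => hxL (hLdown x y hxy hyL)⟩
  have σsubα₂ : ∀ y, y ∈ σ → y ∈ α₂ := by
    intro y hy; rw [memσ] at hy
    rcases hy with hy | ⟨hy, _⟩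
    · exact Usubα₂ y hy
    · exact hnest hy
  have σPα₃ : ∀ y, y ∈ σ → y ∉ L → y ∈ α₃ := by
    intro y hy hyL; rw [memσ] at hy
    rcases hy with hy | ⟨hy, _⟩
    · exact UPα₃ y hy hyL
    · exact hy
  have α₂Lσ : ∀ x, x ∈ L → x ∈ α₂ → x ∈ σ := by
    intro x hxL hx; rw [memσ]; exact Or.inl ((memU x).2 ⟨x, hx, hxL, hrefl x⟩)
  have α₃subσ : ∀ x, x ∈ α₃ → x ∈ σ := by
    intro x hx; by_cases hxL : x ∈ L
    · exact α₂Lσ x hxL (hnest hx)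
    · rw [memσ]; exact Or.inr ⟨hx, hxL⟩
  have γup : ∀ x y, r x y → x ∈ γ → y ∈ γ := by
    intro x y hxy hx; rw [memγ] at hx ⊢
    rcases hx with hx | hx
    · exact Or.inl (Uup x y hxy hx)
    · exact Or.inr (hα₃ x y hxy hx)
  have σsubγ : ∀ y, y ∈ σ → y ∈ γ := by
    intro y hy; rw [memσ] at hy; rw [memγ]
    rcases hy with hy | ⟨hy, _⟩
    · exact Or.inl hy
    · exact Or.inr hy
  have γsubα₂ : ∀ y, y ∈ γ → y ∈ α₂ := by
    intro y hy; rw [memγ] at hy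
    rcases hy with hy | hy
    · exact Usubα₂ y hy
    · exact hnest hy
  have β₃'up : ∀ x y, r x y → x ∈ β₃' → y ∈ β₃' := by
    intro x y hxy hx; rw [memβ₃'] at hx ⊢
    obtain ⟨hx3, hx'⟩ := hx
    refine ⟨hβ₃ x y hxy hx3, ?_⟩
    by_cases hyL : y ∈ L
    · have hxL : x ∈ L := hLdown x y hxy hyL
      rcases hx' with hx' | hx'
      · exact absurd hxL hx'
      · exact Or.inr fun t hyt htL => hx' t (htrans _ _ _ hxy hyt) htL
    · exact Or.inl hyL
  have Wup : ∀ x y, r x y → x ∈ W → y ∈ W := by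
    intro x y hxy hx; rw [memW] at hx ⊢
    obtain ⟨hxL, z, hz, hzL, hzx⟩ := hx
    exact ⟨fun hyL => hxL (hLdown x y hxy hyL), z, hz, hzL, htrans _ _ _ hzx hxy⟩
  have q₂up : ∀ x y, r x y → x ∈ q₂ → y ∈ q₂ := by
    intro x y hxy hx; rw [memq₂] at hx ⊢
    rcases hx with hx | hx
    · exact Or.inl (hβ₂ x y hxy hx)
    · exact Or.inr (Wup x y hxy hx)
  have eup : ∀ x y : X, r x y → x ∈ (∅ : Finset X) → y ∈ (∅ : Finset X) := fun x y _ hx => absurd hx (Finset.notMem_empty x)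
  have uup : ∀ x y : X, r x y → x ∈ (Finset.univ : Finset X) → y ∈ (Finset.univ : Finset X) := fun x y _ _ => Finset.mem_univ y
  -- up-closedness of the eight sheet-built sets (AntitheticWedgeQuad.quad_upset)
  have upT := AntitheticWedgeQuadRel.quad_upset_rel r L σ α₃ σ σ σup hα₃ σup σup (Finset.Subset.refl _) (fun y hy => α₃subσ y hy)
    (fun x _ hx => hx) (fun x hxL hx => σPα₃ x hx hxL) (fun x y hxy _ _ hx => σup x y hxy (α₃subσ x hx))
  have upS := AntitheticWedgeQuadRel.quad_upset_rel r L σ σ α₂ σ σup σup hα₂ σup (fun y hy => σsubα₂ y hy) (Finset.Subset.refl _)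
    (fun x hxL hx => α₂Lσ x hxL hx) (fun x _ hx => hx)
    (fun x y hxy _ _ hx => hα₂ x y hxy (σsubα₂ x hx))
  have upA4 := AntitheticWedgeQuadRel.quad_upset_rel r L σ γ α₂ γ σup γup hα₂ γup (fun y hy => σsubα₂ y hy) (Finset.Subset.refl _)
    (fun x hxL hx => σsubγ x (α₂Lσ x hxL hx)) (fun x _ hx => σsubγ x hx)
    (fun x y hxy _ _ hx => hα₂ x y hxy (γsubα₂ x hx))
  have upU := AntitheticWedgeQuadRel.quad_upset_rel r L (∅ : Finset X) (∅ : Finset X) β₂ (Finset.univ : Finset X) eup eup hβ₂ uup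
    (Finset.empty_subset _) (Finset.empty_subset _) (fun x _ _ => Finset.mem_univ x) (fun x _ hx => hx)
    (fun x y _ _ _ hx => absurd hx (Finset.notMem_empty x))
  have upV := AntitheticWedgeQuadRel.quad_upset_rel r L (∅ : Finset X) β₃ (Finset.univ : Finset X) (Finset.univ : Finset X) eup hβ₃ uup uup
    (Finset.empty_subset _) (Finset.subset_univ _) (fun x _ _ => Finset.mem_univ x) (fun x _ hx => absurd hx (Finset.notMem_empty x))
    (fun x y _ _ _ _ => Finset.mem_univ y)
  have upP := AntitheticWedgeQuadRel.quad_upset_rel r L (∅ : Finset X) β₃' β₂ (Finset.univ : Finset X) eup β₃'up hβ₂ uup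
    (Finset.empty_subset _) (Finset.subset_univ _) (fun x _ _ => Finset.mem_univ x) (fun x _ hx => absurd hx (Finset.notMem_empty x))
    (fun x y hxy hxL hyL hx => by
      rw [memβ₃'] at hx
      rcases hx.2 with h' | h'
      · exact absurd hxL h'
      · exact h' y hxy hyL)
  have upQ := AntitheticWedgeQuadRel.quad_upset_rel r L (∅ : Finset X) β₃ q₂ (Finset.univ : Finset X) eup hβ₃ q₂up uup
    (Finset.empty_subset _) (Finset.subset_univ _) (fun x _ _ => Finset.mem_univ x) (fun x _ hx => absurd hx (Finset.notMem_empty x))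
    (fun x y hxy hxL hyL hx => by rw [memq₂, memW]; exact Or.inr ⟨hyL, x, hx, hxL, hxy⟩)
  -- the twelve pattern conditions with respect to the new half L_T = sheets 0, 1
  have a13 : (σ ×ˢ ({0} : Finset (Fin 4)) ∪ α₃ ×ˢ ({1} : Finset (Fin 4)) ∪ σ ×ˢ ({2} : Finset (Fin 4)) ∪ σ ×ˢ ({3} : Finset (Fin 4))) ⊆ (σ ×ˢ ({0} : Finset (Fin 4)) ∪ α₃ ×ˢ ({1} : Finset (Fin 4)) ∪ σ ×ˢ ({2} : Finset (Fin 4)) ∪ σ ×ˢ ({3} : Finset (Fin 4))) := Finset.Subset.refl _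
  have a24 : (σ ×ˢ ({0} : Finset (Fin 4)) ∪ σ ×ˢ ({1} : Finset (Fin 4)) ∪ α₂ ×ˢ ({2} : Finset (Fin 4)) ∪ σ ×ˢ ({3} : Finset (Fin 4))) ⊆ (σ ×ˢ ({0} : Finset (Fin 4)) ∪ γ ×ˢ ({1} : Finset (Fin 4)) ∪ α₂ ×ˢ ({2} : Finset (Fin 4)) ∪ γ ×ˢ ({3} : Finset (Fin 4))) := by
    rintro ⟨x, i⟩ hp
    rw [AntitheticWedgeQuad.mem_quad] at hp ⊢
    rcases hp with ⟨hi, hm⟩ | ⟨hi, hm⟩ | ⟨hi, hm⟩ | ⟨hi, hm⟩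
    · exact Or.inl ⟨hi, hm⟩
    · exact Or.inr (Or.inl ⟨hi, σsubγ x hm⟩)
    · exact Or.inr (Or.inr (Or.inl ⟨hi, hm⟩))
    · exact Or.inr (Or.inr (Or.inr ⟨hi, σsubγ x hm⟩))
  have a34 : ∀ p : X × Fin 4, p.2 ≤ 1 → p ∈ (σ ×ˢ ({0} : Finset (Fin 4)) ∪ α₃ ×ˢ ({1} : Finset (Fin 4)) ∪ σ ×ˢ ({2} : Finset (Fin 4)) ∪ σ ×ˢ ({3} : Finset (Fin 4))) → p ∈ (σ ×ˢ ({0} : Finset (Fin 4)) ∪ γ ×ˢ ({1} : Finset (Fin 4)) ∪ α₂ ×ˢ ({2} : Finset (Fin 4)) ∪ γ ×ˢ ({3} : Finset (Fin 4))) := by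
    rintro ⟨x, i⟩ hi hp
    simp only at hi
    rw [AntitheticWedgeQuad.mem_quad] at hp ⊢
    rcases hp with ⟨rfl, hm⟩ | ⟨rfl, hm⟩ | ⟨rfl, hm⟩ | ⟨rfl, hm⟩
    · exact Or.inl ⟨rfl, hm⟩
    · exact Or.inr (Or.inl ⟨rfl, by rw [memγ]; exact Or.inr hm⟩)
    · exact absurd hi (by decide)
    · exact absurd hi (by decide)
  have a12 : ∀ p : X × Fin 4, ¬ p.2 ≤ 1 → p ∈ (σ ×ˢ ({0} : Finset (Fin 4)) ∪ α₃ ×ˢ ({1} : Finset (Fin 4)) ∪ σ ×ˢ ({2} : Finset (Fin 4)) ∪ σ ×ˢ ({3} : Finset (Fin 4))) → p ∈ (σ ×ˢ ({0} : Finset (Fin 4)) ∪ σ ×ˢ ({1} : Finset (Fin 4)) ∪ α₂ ×ˢ ({2} : Finset (Fin 4)) ∪ σ ×ˢ ({3} : Finset (Fin 4))) := by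
    rintro ⟨x, i⟩ hi hp
    simp only at hi
    rw [AntitheticWedgeQuad.mem_quad] at hp ⊢
    rcases hp with ⟨rfl, hm⟩ | ⟨rfl, hm⟩ | ⟨rfl, hm⟩ | ⟨rfl, hm⟩
    · exact absurd (by decide) hi
    · exact absurd (by decide) hi
    · exact Or.inr (Or.inr (Or.inl ⟨rfl, σsubα₂ x hm⟩))
    · exact Or.inr (Or.inr (Or.inr ⟨rfl, hm⟩))
  have aC34 : ∀ p q : X × Fin 4, (r p.1 q.1 ∧ (p.2 = q.2 ∨ (p.2 = 0 ∧ q.2 = 2) ∨ (p.2 = 1 ∧ q.2 = 3) ∨ (p.2 = 0 ∧ q.2 = 3) ∨ (p.2 = 2 ∧ q.2 = 3 ∧ p.1 ∈ L) ∨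
        (p.2 = 0 ∧ q.2 = 1 ∧ q.1 ∉ L) ∨ (p.2 = 1 ∧ q.2 = 2 ∧ p.1 ∈ L ∧ q.1 ∉ L))) → p.2 ≤ 1 → ¬ q.2 ≤ 1 → p ∈ (σ ×ˢ ({0} : Finset (Fin 4)) ∪ α₃ ×ˢ ({1} : Finset (Fin 4)) ∪ σ ×ˢ ({2} : Finset (Fin 4)) ∪ σ ×ˢ ({3} : Finset (Fin 4))) → q ∈ (σ ×ˢ ({0} : Finset (Fin 4)) ∪ γ ×ˢ ({1} : Finset (Fin 4)) ∪ α₂ ×ˢ ({2} : Finset (Fin 4)) ∪ γ ×ˢ ({3} : Finset (Fin 4))) := by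
    rintro ⟨x, i⟩ ⟨y, j⟩ ⟨hxy, -⟩ hi hj hp
    simp only at hxy hi hj
    rw [AntitheticWedgeQuad.mem_quad] at hp ⊢
    have hx : x ∈ α₂ ∧ x ∈ γ := by
      rcases hp with ⟨rfl, hm⟩ | ⟨rfl, hm⟩ | ⟨rfl, hm⟩ | ⟨rfl, hm⟩
      · exact ⟨σsubα₂ x hm, σsubγ x hm⟩
      · exact ⟨hnest hm, by rw [memγ]; exact Or.inr hm⟩
      · exact absurd hi (by decide)
      · exact absurd hi (by decide)
    have hy2 : y ∈ α₂ := hα₂ x y hxy hx.1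
    have hyγ : y ∈ γ := γup x y hxy hx.2
    fin_cases j
    · exact absurd (by decide) hj
    · exact absurd (by decide) hj
    · exact Or.inr (Or.inr (Or.inl ⟨rfl, hy2⟩))
    · exact Or.inr (Or.inr (Or.inr ⟨rfl, hyγ⟩))
  have aC23 : ∀ p q : X × Fin 4, (r p.1 q.1 ∧ (p.2 = q.2 ∨ (p.2 = 0 ∧ q.2 = 2) ∨ (p.2 = 1 ∧ q.2 = 3) ∨ (p.2 = 0 ∧ q.2 = 3) ∨ (p.2 = 2 ∧ q.2 = 3 ∧ p.1 ∈ L) ∨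
        (p.2 = 0 ∧ q.2 = 1 ∧ q.1 ∉ L) ∨ (p.2 = 1 ∧ q.2 = 2 ∧ p.1 ∈ L ∧ q.1 ∉ L))) → p.2 ≤ 1 → ¬ q.2 ≤ 1 → p ∈ (σ ×ˢ ({0} : Finset (Fin 4)) ∪ σ ×ˢ ({1} : Finset (Fin 4)) ∪ α₂ ×ˢ ({2} : Finset (Fin 4)) ∪ σ ×ˢ ({3} : Finset (Fin 4))) → q ∈ (σ ×ˢ ({0} : Finset (Fin 4)) ∪ α₃ ×ˢ ({1} : Finset (Fin 4)) ∪ σ ×ˢ ({2} : Finset (Fin 4)) ∪ σ ×ˢ ({3} : Finset (Fin 4))) := by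
    rintro ⟨x, i⟩ ⟨y, j⟩ ⟨hxy, -⟩ hi hj hp
    simp only at hxy hi hj
    rw [AntitheticWedgeQuad.mem_quad] at hp ⊢
    have hx : x ∈ σ := by
      rcases hp with ⟨rfl, hm⟩ | ⟨rfl, hm⟩ | ⟨rfl, hm⟩ | ⟨rfl, hm⟩
      · exact hm
      · exact hm
      · exact absurd hi (by decide)
      · exact absurd hi (by decide)
    have hy : y ∈ σ := σup x y hxy hx
    fin_cases j
    · exact absurd (by decide) hj
    · exact absurd (by decide) hj
    · exact Or.inr (Or.inr (Or.inl ⟨rfl, hy⟩))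
    · exact Or.inr (Or.inr (Or.inr ⟨rfl, hy⟩))
  have b13 : ((∅ : Finset X) ×ˢ ({0} : Finset (Fin 4)) ∪ β₃' ×ˢ ({1} : Finset (Fin 4)) ∪ β₂ ×ˢ ({2} : Finset (Fin 4)) ∪ (Finset.univ : Finset X) ×ˢ ({3} : Finset (Fin 4))) ⊆ ((∅ : Finset X) ×ˢ ({0} : Finset (Fin 4)) ∪ β₃ ×ˢ ({1} : Finset (Fin 4)) ∪ (Finset.univ : Finset X) ×ˢ ({2} : Finset (Fin 4)) ∪ (Finset.univ : Finset X) ×ˢ ({3} : Finset (Fin 4))) := by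
    rintro ⟨x, i⟩ hp
    rw [AntitheticWedgeQuad.mem_quad] at hp ⊢
    rcases hp with ⟨hi, hm⟩ | ⟨hi, hm⟩ | ⟨hi, hm⟩ | ⟨hi, hm⟩
    · exact absurd hm (Finset.notMem_empty x)
    · exact Or.inr (Or.inl ⟨hi, ((memβ₃' x).1 hm).1⟩)
    · exact Or.inr (Or.inr (Or.inl ⟨hi, Finset.mem_univ x⟩))
    · exact Or.inr (Or.inr (Or.inr ⟨hi, hm⟩))
  have b24 : ((∅ : Finset X) ×ˢ ({0} : Finset (Fin 4)) ∪ (∅ : Finset X) ×ˢ ({1} : Finset (Fin 4)) ∪ β₂ ×ˢ ({2} : Finset (Fin 4)) ∪ (Finset.univ : Finset X) ×ˢ ({3} : Finset (Fin 4))) ⊆ ((∅ : Finset X) ×ˢ ({0} : Finset (Fin 4)) ∪ β₃ ×ˢ ({1} : Finset (Fin 4)) ∪ q₂ ×ˢ ({2} : Finset (Fin 4)) ∪ (Finset.univ : Finset X) ×ˢ ({3} : Finset (Fin 4))) := by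
    rintro ⟨x, i⟩ hp
    rw [AntitheticWedgeQuad.mem_quad] at hp ⊢
    rcases hp with ⟨hi, hm⟩ | ⟨hi, hm⟩ | ⟨hi, hm⟩ | ⟨hi, hm⟩
    · exact absurd hm (Finset.notMem_empty x)
    · exact absurd hm (Finset.notMem_empty x)
    · exact Or.inr (Or.inr (Or.inl ⟨hi, (memq₂ x).2 (Or.inl hm)⟩))
    · exact Or.inr (Or.inr (Or.inr ⟨hi, hm⟩))
  have b34 : ∀ p : X × Fin 4, p.2 ≤ 1 → p ∈ ((∅ : Finset X) ×ˢ ({0} : Finset (Fin 4)) ∪ β₃ ×ˢ ({1} : Finset (Fin 4)) ∪ (Finset.univ : Finset X) ×ˢ ({2} : Finset (Fin 4)) ∪ (Finset.univ : Finset X) ×ˢ ({3} : Finset (Fin 4))) → p ∈ ((∅ : Finset X) ×ˢ ({0} : Finset (Fin 4)) ∪ β₃ ×ˢ ({1} : Finset (Fin 4)) ∪ q₂ ×ˢ ({2} : Finset (Fin 4)) ∪ (Finset.univ : Finset X) ×ˢ ({3} : Finset (Fin 4))) := by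
    rintro ⟨x, i⟩ hi hp
    simp only at hi
    rw [AntitheticWedgeQuad.mem_quad] at hp ⊢
    rcases hp with ⟨rfl, hm⟩ | ⟨rfl, hm⟩ | ⟨rfl, hm⟩ | ⟨rfl, hm⟩
    · exact absurd hm (Finset.notMem_empty x)
    · exact Or.inr (Or.inl ⟨rfl, hm⟩)
    · exact absurd hi (by decide)
    · exact absurd hi (by decide)
  have b12 : ∀ p : X × Fin 4, ¬ p.2 ≤ 1 → p ∈ ((∅ : Finset X) ×ˢ ({0} : Finset (Fin 4)) ∪ β₃' ×ˢ ({1} : Finset (Fin 4)) ∪ β₂ ×ˢ ({2} : Finset (Fin 4)) ∪ (Finset.univ : Finset X) ×ˢ ({3} : Finset (Fin 4))) → p ∈ ((∅ : Finset X) ×ˢ ({0} : Finset (Fin 4)) ∪ (∅ : Finset X) ×ˢ ({1} : Finset (Fin 4)) ∪ β₂ ×ˢ ({2} : Finset (Fin 4)) ∪ (Finset.univ : Finset X) ×ˢ ({3} : Finset (Fin 4))) := by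
    rintro ⟨x, i⟩ hi hp
    simp only at hi
    rw [AntitheticWedgeQuad.mem_quad] at hp ⊢
    rcases hp with ⟨rfl, hm⟩ | ⟨rfl, hm⟩ | ⟨rfl, hm⟩ | ⟨rfl, hm⟩
    · exact absurd (by decide) hi
    · exact absurd (by decide) hi
    · exact Or.inr (Or.inr (Or.inl ⟨rfl, hm⟩))
    · exact Or.inr (Or.inr (Or.inr ⟨rfl, hm⟩))
  have bC34 : ∀ p q : X × Fin 4, (r p.1 q.1 ∧ (p.2 = q.2 ∨ (p.2 = 0 ∧ q.2 = 2) ∨ (p.2 = 1 ∧ q.2 = 3) ∨ (p.2 = 0 ∧ q.2 = 3) ∨ (p.2 = 2 ∧ q.2 = 3 ∧ p.1 ∈ L) ∨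
        (p.2 = 0 ∧ q.2 = 1 ∧ q.1 ∉ L) ∨ (p.2 = 1 ∧ q.2 = 2 ∧ p.1 ∈ L ∧ q.1 ∉ L))) → p.2 ≤ 1 → ¬ q.2 ≤ 1 → p ∈ ((∅ : Finset X) ×ˢ ({0} : Finset (Fin 4)) ∪ β₃ ×ˢ ({1} : Finset (Fin 4)) ∪ (Finset.univ : Finset X) ×ˢ ({2} : Finset (Fin 4)) ∪ (Finset.univ : Finset X) ×ˢ ({3} : Finset (Fin 4))) → q ∈ ((∅ : Finset X) ×ˢ ({0} : Finset (Fin 4)) ∪ β₃ ×ˢ ({1} : Finset (Fin 4)) ∪ q₂ ×ˢ ({2} : Finset (Fin 4)) ∪ (Finset.univ : Finset X) ×ˢ ({3} : Finset (Fin 4))) := by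
    rintro ⟨x, i⟩ ⟨y, j⟩ ⟨hxy, hc⟩ hi hj hp
    simp only at hxy hc hi hj
    rw [AntitheticWedgeQuad.mem_quad] at hp ⊢
    have hx : i = 1 ∧ x ∈ β₃ := by
      rcases hp with ⟨rfl, hm⟩ | ⟨rfl, hm⟩ | ⟨rfl, hm⟩ | ⟨rfl, hm⟩
      · exact absurd hm (Finset.notMem_empty x)
      · exact ⟨rfl, hm⟩
      · exact absurd hi (by decide)
      · exact absurd hi (by decide)
    obtain ⟨rfl, hxβ⟩ := hx
    fin_cases j
    · exact absurd (by decide) hj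
    · exact absurd (by decide) hj
    · -- sheet 1 → sheet 2 requires x ∈ L, y ∉ L: then y ∈ ↑(β₃ ∩ L) ∖ L ⊆ q₂
      have hL : x ∈ L ∧ y ∉ L := by
        rcases hc with h | ⟨h, -⟩ | ⟨-, h⟩ | ⟨h, -⟩ | ⟨h, -⟩ | ⟨h, -⟩ | ⟨-, -, hxL, hyL⟩
        · exact absurd h (by decide)
        · exact absurd h (by decide)
        · exact absurd h (by decide)
        · exact absurd h (by decide)
        · exact absurd h (by decide)
        · exact absurd h (by decide)
        · exact ⟨hxL, hyL⟩
      refine Or.inr (Or.inr (Or.inl ⟨rfl, ?_⟩))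
      rw [memq₂, memW]
      exact Or.inr ⟨hL.2, x, hxβ, hL.1, hxy⟩
    · exact Or.inr (Or.inr (Or.inr ⟨rfl, Finset.mem_univ y⟩))
  have bC23 : ∀ p q : X × Fin 4, (r p.1 q.1 ∧ (p.2 = q.2 ∨ (p.2 = 0 ∧ q.2 = 2) ∨ (p.2 = 1 ∧ q.2 = 3) ∨ (p.2 = 0 ∧ q.2 = 3) ∨ (p.2 = 2 ∧ q.2 = 3 ∧ p.1 ∈ L) ∨
        (p.2 = 0 ∧ q.2 = 1 ∧ q.1 ∉ L) ∨ (p.2 = 1 ∧ q.2 = 2 ∧ p.1 ∈ L ∧ q.1 ∉ L))) → p.2 ≤ 1 → ¬ q.2 ≤ 1 → p ∈ ((∅ : Finset X) ×ˢ ({0} : Finset (Fin 4)) ∪ (∅ : Finset X) ×ˢ ({1} : Finset (Fin 4)) ∪ β₂ ×ˢ ({2} : Finset (Fin 4)) ∪ (Finset.univ : Finset X) ×ˢ ({3} : Finset (Fin 4))) → q ∈ ((∅ : Finset X) ×ˢ ({0} : Finset (Fin 4)) ∪ β₃ ×ˢ ({1} : Finset (Fin 4)) ∪ (Finset.univ :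 Finset X) ×ˢ ({2} : Finset (Fin 4)) ∪ (Finset.univ : Finset X) ×ˢ ({3} : Finset (Fin 4))) := by
    rintro ⟨x, i⟩ ⟨y, j⟩ - hi - hp
    simp only at hi
    rw [AntitheticWedgeQuad.mem_quad] at hp
    rcases hp with ⟨rfl, hm⟩ | ⟨rfl, hm⟩ | ⟨rfl, hm⟩ | ⟨rfl, hm⟩
    · exact absurd hm (Finset.notMem_empty x)
    · exact absurd hm (Finset.notMem_empty x)
    · exact absurd hi (by decide)
    · exact absurd hi (by decide)
  -- the five cardinalities
  have hsurj : (Finset.univ : Finset X).image ι = Finset.univ := Finset.image_univ_of_surjective hι.surjective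
  have c1 : ((σ ×ˢ ({0} : Finset (Fin 4)) ∪ σ ×ˢ ({1} : Finset (Fin 4)) ∪ α₂ ×ˢ ({2} : Finset (Fin 4)) ∪ σ ×ˢ ({3} : Finset (Fin 4))) ∩ ((∅ : Finset X) ×ˢ ({0} : Finset (Fin 4)) ∪ β₃ ×ˢ ({1} : Finset (Fin 4)) ∪ (Finset.univ : Finset X) ×ˢ ({2} : Finset (Fin 4)) ∪ (Finset.univ : Finset X) ×ˢ ({3} : Finset (Fin 4))).image (fun p => (ι p.1, s p.2))).card = σ.card + σ.card + (α₂ ∩ β₃.image ι).card := by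
    rw [AntitheticWedgeQuad.quad_image ι s hs0 hs1 hs2 hs3, AntitheticWedgeQuad.quad_inter, AntitheticWedgeQuad.card_quad]
    simp [hsurj]
  have c2 : ((σ ×ˢ ({0} : Finset (Fin 4)) ∪ α₃ ×ˢ ({1} : Finset (Fin 4)) ∪ σ ×ˢ ({2} : Finset (Fin 4)) ∪ σ ×ˢ ({3} : Finset (Fin 4))) ∩ ((∅ : Finset X) ×ˢ ({0} : Finset (Fin 4)) ∪ (∅ : Finset X) ×ˢ ({1} : Finset (Fin 4)) ∪ β₂ ×ˢ ({2} : Finset (Fin 4)) ∪ (Finset.univ : Finset X) ×ˢ ({3} : Finset (Fin 4))).image (fun p => (ι p.1, s p.2))).card = σ.card + (α₃ ∩ β₂.image ι).card := by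
    rw [AntitheticWedgeQuad.quad_image ι s hs0 hs1 hs2 hs3, AntitheticWedgeQuad.quad_inter, AntitheticWedgeQuad.card_quad]
    simp [hsurj]
  have c3 : ((σ ×ˢ ({0} : Finset (Fin 4)) ∪ σ ×ˢ ({1} : Finset (Fin 4)) ∪ α₂ ×ˢ ({2} : Finset (Fin 4)) ∪ σ ×ˢ ({3} : Finset (Fin 4))) ∩ ((∅ : Finset X) ×ˢ ({0} : Finset (Fin 4)) ∪ (∅ : Finset X) ×ˢ ({1} : Finset (Fin 4)) ∪ β₂ ×ˢ ({2} : Finset (Fin 4)) ∪ (Finset.univ : Finset X) ×ˢ ({3} : Finset (Fin 4)))).card = (α₂ ∩ β₂).card + σ.card := by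
    rw [AntitheticWedgeQuad.quad_inter, AntitheticWedgeQuad.card_quad]
    simp
  have c4 : ((σ ×ˢ ({0} : Finset (Fin 4)) ∪ α₃ ×ˢ ({1} : Finset (Fin 4)) ∪ σ ×ˢ ({2} : Finset (Fin 4)) ∪ σ ×ˢ ({3} : Finset (Fin 4))) ∩ ((∅ : Finset X) ×ˢ ({0} : Finset (Fin 4)) ∪ β₃ ×ˢ ({1} : Finset (Fin 4)) ∪ (Finset.univ : Finset X) ×ˢ ({2} : Finset (Fin 4)) ∪ (Finset.univ : Finset X) ×ˢ ({3} : Finset (Fin 4)))).card = (α₃ ∩ β₃).card + σ.card + σ.card := by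
    rw [AntitheticWedgeQuad.quad_inter, AntitheticWedgeQuad.card_quad]
    simp [Nat.add_assoc]
  have c5 : (((σ ×ˢ ({0} : Finset (Fin 4)) ∪ γ ×ˢ ({1} : Finset (Fin 4)) ∪ α₂ ×ˢ ({2} : Finset (Fin 4)) ∪ γ ×ˢ ({3} : Finset (Fin 4))) \ (σ ×ˢ ({0} : Finset (Fin 4)) ∪ α₃ ×ˢ ({1} : Finset (Fin 4)) ∪ σ ×ˢ ({2} : Finset (Fin 4)) ∪ σ ×ˢ ({3} : Finset (Fin 4)))) ∩ (((∅ : Finset X) ×ˢ ({0} : Finset (Fin 4)) ∪ β₃ ×ˢ ({1} : Finset (Fin 4)) ∪ q₂ ×ˢ ({2} : Finset (Fin 4)) ∪ (Finset.univ : Finset X) ×ˢ ({3} : Finset (Fin 4))) \ ((∅ : Finset X) ×ˢ ({0} : Finset (Fin 4)) ∪ β₃' ×ˢ ({1} : Finset (Fin 4)) ∪ β₂ ×ˢ ({2} : Finset (Fin 4)) ∪ (Finset.univ : Finset X) ×ˢ ({3} : Finset (Fin 4))))).card = ((γ \ α₃) ∩ (β₃ \ β₃')).card + ((α₂ \ σ)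 ∩ (q₂ \ β₂)).card := by
    rw [AntitheticWedgeQuad.quad_sdiff, AntitheticWedgeQuad.quad_sdiff, AntitheticWedgeQuad.quad_inter, AntitheticWedgeQuad.card_quad]
    simp
  -- the relay term of the template is at most the relay term of the X-level violation
  have hS : ((γ \ α₃) ∩ (β₃ \ β₃')).card + ((α₂ \ σ) ∩ (q₂ \ β₂)).card ≤ ((A₄ \ A₁) ∩ (B₄ \ B₁)).card := by
    have hdisj : Disjoint ((γ \ α₃) ∩ (β₃ \ β₃')) ((α₂ \ σ) ∩ (q₂ \ β₂)) := by
      rw [Finset.disjoint_left]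
      intro x hx1 hx2
      rw [Finset.mem_inter, Finset.mem_sdiff, Finset.mem_sdiff] at hx1 hx2
      have hxL : x ∈ L := by
        by_contra hxL
        exact hx1.2.2 ((memβ₃' x).2 ⟨hx1.2.1, Or.inl hxL⟩)
      have hxW : x ∈ W := by
        have := (memq₂ x).1 hx2.2.1
        rcases this with h' | h'
        · exact absurd h' hx2.2.2
        · exact h'
      exact ((memW x).1 hxW).1 hxL
    rw [← Finset.card_union_of_disjoint hdisj]
    apply Finset.card_le_card
    intro x hx
    rw [Finset.mem_union] at hx
    rw [Finset.mem_inter, Finset.mem_sdiff, Finset.mem_sdiff]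
    rcases hx with hx | hx
    · rw [Finset.mem_inter, Finset.mem_sdiff, Finset.mem_sdiff] at hx
      obtain ⟨⟨hxγ, hxα₃⟩, hxβ₃, hxβ₃'⟩ := hx
      have hxU : x ∈ U := by
        rcases (memγ x).1 hxγ with h' | h'
        · exact h'
        · exact absurd h' hxα₃
      have hxL : x ∈ L := by
        by_contra hxL
        exact hxβ₃' ((memβ₃' x).2 ⟨hxβ₃, Or.inl hxL⟩)
      -- a witness t ≥ x outside L and outside β₂
      have hnot : ¬ (∀ t, r x t → t ∉ L → t ∈ β₂) := fun hall => hxβ₃' ((memβ₃' x).2 ⟨hxβ₃, Or.inr hall⟩)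
      push Not at hnot
      obtain ⟨t, hxt, htL, htβ₂⟩ := hnot
      refine ⟨⟨hA₄ (Usubα₂ x hxU), fun hxA₁ => hxα₃ (hA₁ hxA₁)⟩, hB₃₄ x hxL hxβ₃, fun hxB₁ => htβ₂ (hB₁₂ t htL (hB₁ x t hxt hxB₁))⟩
    · rw [Finset.mem_inter, Finset.mem_sdiff, Finset.mem_sdiff] at hx
      obtain ⟨⟨hxα₂, hxσ⟩, hxq₂, hxβ₂⟩ := hx
      have hxW : x ∈ W := by
        rcases (memq₂ x).1 hxq₂ with h' | h'
        · exact absurd h' hxβ₂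
        · exact h'
      obtain ⟨hxL, z, hzβ₃, hzL, hzx⟩ := (memW x).1 hxW
      refine ⟨⟨hA₄ hxα₂, fun hxA₁ => hxσ (α₃subσ x (hA₁ hxA₁))⟩, hBC z x hzx hzL hxL hzβ₃, fun hxB₁ => hxβ₂ (hB₁₂ x hxL hxB₁)⟩

  -- nestedness of the lifted configuration: 𝐭 ⊆ 𝐬
  have hnest' : (σ ×ˢ ({0} : Finset (Fin 4)) ∪ α₃ ×ˢ ({1} : Finset (Fin 4)) ∪ σ ×ˢ ({2} : Finset (Fin 4)) ∪ σ ×ˢ ({3} : Finset (Fin 4))) ⊆ (σ ×ˢ ({0} : Finset (Fin 4)) ∪ σ ×ˢ ({1} : Finset (Fin 4)) ∪ α₂ ×ˢ ({2} : Finset (Fin 4)) ∪ σ ×ˢ ({3} : Finset (Fin 4))) := by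
    rintro ⟨x, i⟩ hp
    rw [AntitheticWedgeQuad.mem_quad] at hp ⊢
    rcases hp with ⟨hi, hm⟩ | ⟨hi, hm⟩ | ⟨hi, hm⟩ | ⟨hi, hm⟩
    · exact Or.inl ⟨hi, hm⟩
    · exact Or.inr (Or.inl ⟨hi, α₃subσ x hm⟩)
    · exact Or.inr (Or.inr (Or.inl ⟨hi, σsubα₂ x hm⟩))
    · exact Or.inr (Or.inr (Or.inr ⟨hi, hm⟩))
  refine ⟨_, _, _, _, _, _, _, _, upT, upS, upT, upA4, upP, upU, upV, upQ, a13, a24, a34, a12, aC34, aC23, b13, b24, b34, b12, bC34, bC23, hnest', ?_⟩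
  rw [c1, c2, c3, c4, c5]
  omega

end AntitheticWedgeConverseRel

end Summit.CriticalPhenomena.PercolationContinuityZ3.Theorems
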